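import Mathlib.RingTheory.Nilpotent.Exp
import Mathlib.Algebra.Polynomial.Derivative
import Mathlib.Algebra.MvPolynomial.Derivation
import Mathlib.Algebra.MvPolynomial.PDeriv
import Mathlib.LinearAlgebra.Matrix.Charpoly.Coeff
import Literature.NumberTheory.Automorphic.LieAlgebraGLDerivation
import Literature.NumberTheory.Automorphic.NilpotentExpRootHom
import Literature.NumberTheory.Automorphic.RootDataProofs
import HarnessLib

/-!
# Nilpotent elements of the Lie algebra exponentiate into the group (characteristic `0`)
(trunk T-AUTOMORPHIC, G25 AutomorphicL; serves Springer 8.1.2 / 8.1.3 (ii) on the DAG of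
`Literature.NumberTheory.Automorphic.chevalley_isomorphism`)

Companion to `LieAlgebraGL.lean`, `LieAlgebraGLDerivation.lean` and `NilpotentExpRootHom.lean` (namespace
`Literature.NumberTheory.Automorphic`, concrete `k`-points vocabulary: algebraic subgroups
`G ≤ GL n k` (`IsAlgebraicSubgroup`), the Lie algebra `lieAlgebraGL G ⊆ 𝔤𝔩ₙ` as the tangent
space at `1` cut out by the differentials `tangentDeriv p A` of the vanishing ideal `𝓘(G)`,
weight spaces `weightSpaceGL T α`, `lieWeightSpace G T α = 𝔤_α`, the non-zero weights
`lieWeights G T` (Springer's `P`, 7.1.1), the roots `roots G T` defined through root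
homomorphisms (8.1.1 (i)) and the exponential one-parameter groups `expHom A : x ↦ exp (x A)` of
nilpotent matrices). `NilpotentExpRootHom.lean` shows that `exp (x A)` is a root homomorphism
*provided its values lie in `G`*; this file supplies that proviso from the Lie algebra, i.e. it
proves the nilpotent half of Chevalley's correspondence between algebraic groups and their Lie
algebras in characteristic `0` (Borel, *Linear Algebraic Groups*, Ch. II §7; Humphreys, *Linear
Algebraic Groups*, §13), for closed subgroups of `GL_n`, with real proofs only (no named facts):

* From `LieAlgebraGLDerivation.lean` (imported): the invariant derivation `rDeriv A = D_A` of
  `k[GL_n] = k[x_{ij}, y]` (`D_A x_{ij} = ∑_l x_{il} A_{lj}`, `D_A y = -tr(A) y`,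
  `(D_A p)(g) = d/dε p(g (1 + ε A))`, Springer 4.4.3–4.4.5) and `rDeriv_mem_idealGL`:
  **`A ∈ Lie(G)` implies `D_A 𝓘(G) ⊆ 𝓘(G)`** (Springer 4.4.7).
* `expCurve A N` — the coordinates of `exp (x A)` as polynomials in `x` (`A ^ N = 0`), with
  `derivative_expCurve_inl` (`d/dx exp (x A) = exp (x A) A`) and the **chain rule**
  `derivative_aeval_expCurve`: `d/dx p(exp (x A)) = (D_A p)(exp (x A))`.
* **`expHom_mem_of_mem_lieAlgebraGL`** — for `G` algebraic over a field of characteristic `0`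
  and `A ∈ Lie(G)` nilpotent, `exp (x A) ∈ G` for all `x`. Proof by minimal degree: if some
  `p ∈ 𝓘(G)` has `F_p(x) = p(exp (x A)) ≠ 0`, take one of least degree; `F_p(0) = p(1) = 0`, so
  `F_p` is not constant and `F_p' = F_{D_A p} ≠ 0` has smaller degree although `D_A p ∈ 𝓘(G)`.
  (The textbook route — `p(exp (x A)) = ∑ xᵐ (D_Aᵐ p)(1) / m!` — needs the local nilpotence of
  `D_A`; the degree argument avoids it.)
* `isNilpotent_of_mem_weightSpaceGL` — a weight vector `A` (`t A t⁻¹ = α(t) A`) of a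
  non-trivial algebraic character `α` of a Zariski-connected `T` is nilpotent (any
  characteristic): `det (1 - x A)` is conjugation invariant and `det (1 - x α(t) A) =
  det (1 - x A) ∘ (α(t) x)` (`charpolyRev_smul`), so a non-zero coefficient `c_i`, `i ≥ 1`, would
  give `αⁱ = 1`, impossible as `X*(T)` is torsion-free (`eq_one_of_isZConnected_of_pow_eq_one`,
  Springer 3.2.7 (iii)); hence `det (1 - x A) = 1` and `A` is nilpotent
  (`isNilpotent_of_charpolyRev_eq_one`, Cayley–Hamilton).
* **`lieWeights_subset_roots`**, `lieWeights_eq_roots_of_charZero` — in characteristic `0`,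
  for `G` algebraic and `T ≤ G` Zariski connected, **the non-zero weights of `T` in `Lie(G)` are
  exactly the roots** (`P = R`, the first clause of Springer 8.1.2, here without reductivity or
  maximality: a non-zero `A ∈ 𝔤_α` is nilpotent, `exp (x A) ∈ G`, and `x ↦ exp (x A)` is a root
  homomorphism for `α`, `mem_roots_of_expHom`); `expHom_mem_rootSubgroup_of_mem_lieWeightSpace`.

Consumers: the hypotheses `hPR : lieWeights G T ⊆ roots G T` of
`torus_sup_rootSubgroups_eq_of_lieWeights_subset` (`IsomorphismTheoremUniqueLie.lean`, Springer
8.1.1 (ii) via the Lie algebra) and the first half of the named fact `lieWeights_eq_roots`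
(Springer 8.1.2) are thereby discharged in characteristic `0`; the second half (`dim 𝔤_α = 1`)
becomes equivalent to the uniqueness of root subgroups 8.1.1 (i) (follow-up file), and the
dimension formula 8.1.3 (ii) (`zdim_eq_rank_add_card_roots`, `BigCellOpen.lean`, on the DAG of
`chevalley_isomorphism`) reduces to 8.1.1 (i) and `𝔤^T ⊆ L(T)`.

Not here: the semisimple half of the correspondence (the algebraic hull of a semisimple
`A ∈ Lie(G)` lies in `G`; it gives `𝔤^T ⊆ L(Z_G(T))`, Springer 5.4.7, in characteristic `0`),
and anything in positive characteristic, where all of this fails (Springer 4.4.11, 5.4.9 (1)).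

## Mathlib

`Derivation.leibniz`, `Polynomial.derivative` with `derivative_eq_zero` (characteristic `0`: only constants have zero
derivative) and `natDegree_derivative_lt`, `IsNilpotent.exp` (through `NilpotentExpRootHom`),
`Matrix.charpolyRev` with `Matrix.reverse_charpoly`, `Matrix.charpoly_units_conj`,
`Matrix.eval_charpolyRev`, `Matrix.aeval_self_charpoly`, `Polynomial.comp_C_mul_X_coeff`. Mathlib
has no algebraic groups; nothing here duplicates a Mathlib or Literature declaration (searched
`expHom_mem`, `lieWeights_subset_roots`, `charpolyRev_smul`, `isNilpotent_of_mem`).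

## References

* [SpringerLAG1998] T. A. Springer, *Linear Algebraic Groups*, 2nd ed., Progress in
  Mathematics 9, Birkhäuser (1998): 3.2.7 (iii), 4.4.3–4.4.7, 4.4.10 (3), 7.1.1, 8.1.1 (i),
  Cor. 8.1.2, Cor. 8.1.3 (ii).
* [Borel1991] A. Borel, *Linear Algebraic Groups*, 2nd ed., GTM 126, Springer (1991), Ch. II §7
  (algebraic groups in characteristic `0`).
-/

noncomputable section

open scoped MatrixGroups

namespace Literature.NumberTheory.Automorphic

variable {k : Type*} [Field k] {n : Type*} [Fintype n] [DecidableEq n]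

/-! ### The curve `x ↦ exp (x A)` and the chain rule `d/dx p(exp(xA)) = (D_A p)(exp(xA))` -/

section ExpCurve

open Polynomial

variable [CharZero k] {A : Matrix n n k} {N : ℕ}

/-- The coordinates of `exp (x A)` as polynomials in `x`, for a matrix `A` with `A ^ N = 0`:
the entries `∑_{i<N} xⁱ (Aⁱ)_{ab} / i!` and the constant `1` for `det⁻¹` (`det exp (x A) = 1`).
[folklore] -/
def expCurve (A : Matrix n n k) (N : ℕ) : GLCoord n → k[X]
  | Sum.inl ab => ∑ i ∈ Finset.range N, C (((i.factorial : k)⁻¹ • A ^ i) ab.1 ab.2) * X ^ i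
  | Sum.inr _ => 1

/-- `expCurve` evaluates to the coordinates of `exp (x A)`. [folklore] -/
lemma eval_expCurve (hA : IsNilpotent A) (hN : A ^ N = 0) (x : k) (c : GLCoord n) :
    (expCurve A N c).eval x = glCoordFun (expHom A hA (Multiplicative.ofAdd x)) c := by
  rcases c with ⟨a, b⟩ | u
  · rw [expCurve, glCoordFun_inl, coe_expHom_apply, toAdd_ofAdd, exp_smul_apply_eq_eval hN]
  · rw [expCurve, eval_one, glCoordFun_inr, coe_expHom_apply, toAdd_ofAdd, det_exp_smul hA,
      inv_one]

/-- `p (exp (x A))` is the value at `x` of the polynomial `p ∘ expCurve`. [folklore] -/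
lemma eval_aeval_expCurve (hA : IsNilpotent A) (hN : A ^ N = 0) (p : MvPolynomial (GLCoord n) k)
    (x : k) :
    (MvPolynomial.aeval (expCurve A N) p).eval x =
      MvPolynomial.eval (glCoordFun (expHom A hA (Multiplicative.ofAdd x))) p := by
  have h := MvPolynomial.comp_aeval_apply (expCurve A N) (Polynomial.aeval x) p
  simp only [Polynomial.coe_aeval_eq_eval, MvPolynomial.aeval_eq_eval] at h
  rw [h]
  have hf : (fun i => (expCurve A N i).eval x) =
      glCoordFun (expHom A hA (Multiplicative.ofAdd x)) :=
    funext fun c => eval_expCurve hA hN x c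
  rw [hf]

/-- **`d/dx exp (x A) = exp (x A) · A`** on the entry polynomials (using `A ^ N = 0` to drop the
top term). [folklore] -/
lemma derivative_expCurve_inl (hN : A ^ N = 0) (a b : n) :
    derivative (expCurve A N (Sum.inl (a, b))) =
      ∑ l, expCurve A N (Sum.inl (a, l)) * C (A l b) := by
  have hR : ∑ l, expCurve A N (Sum.inl (a, l)) * C (A l b) =
      ∑ i ∈ Finset.range N, C ((i.factorial : k)⁻¹ * (A ^ (i + 1)) a b) * X ^ i := by
    simp only [expCurve, Finset.sum_mul]
    rw [Finset.sum_comm]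
    refine Finset.sum_congr rfl fun i _ => ?_
    rw [pow_succ, Matrix.mul_apply, Finset.mul_sum, map_sum, Finset.sum_mul]
    refine Finset.sum_congr rfl fun l _ => ?_
    simp only [Matrix.smul_apply, smul_eq_mul, map_mul]
    ring
  rw [hR]
  cases N with
  | zero => simp [expCurve]
  | succ M =>
    simp only [expCurve, derivative_sum, derivative_C_mul_X_pow, Matrix.smul_apply, smul_eq_mul]
    rw [Finset.sum_range_succ', Finset.sum_range_succ, hN]
    simp only [Nat.cast_zero, mul_zero, C_0, zero_mul, add_zero, Matrix.zero_apply]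
    refine Finset.sum_congr rfl fun j _ => ?_
    rw [Nat.add_sub_cancel]
    congr 2
    rw [Nat.factorial_succ, Nat.cast_mul, mul_inv, Nat.cast_succ]
    have hj : ((j : k) + 1) ≠ 0 := Nat.cast_add_one_ne_zero j
    field_simp

omit [CharZero k] in
/-- Nilpotent matrices have trace zero (over a field). [folklore] -/
lemma trace_eq_zero_of_isNilpotent' {A : Matrix n n k} (hA : IsNilpotent A) : Matrix.trace A = 0 :=
  (Matrix.isNilpotent_trace_of_isNilpotent hA).eq_zero

/-- **Chain rule along `exp (x A)`:** `d/dx (p ∘ expCurve) = (D_A p) ∘ expCurve`, i.e.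
`d/dx p(exp (x A)) = (D_A p)(exp (x A))`, because the velocity of the curve at the parameter `x`
is `exp (x A) · A`, the right-invariant vector field of `A`. [folklore] -/
theorem derivative_aeval_expCurve (hA : IsNilpotent A) (hN : A ^ N = 0)
    (p : MvPolynomial (GLCoord n) k) :
    derivative (MvPolynomial.aeval (expCurve A N) p) =
      MvPolynomial.aeval (expCurve A N) (rDeriv A p) := by
  induction p using MvPolynomial.induction_on with
  | C a => rw [rDeriv_C, map_zero, MvPolynomial.aeval_C, Polynomial.algebraMap_eq]; exact derivative_C
  | add p q hp hq => simp only [map_add, hp, hq]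
  | mul_X p c hp =>
    have hc : derivative (expCurve A N c) = MvPolynomial.aeval (expCurve A N) (rDerivVal A c) := by
      rcases c with ⟨a, b⟩ | u
      · rw [derivative_expCurve_inl hN]
        simp only [rDerivVal, map_sum, map_mul, MvPolynomial.aeval_X, MvPolynomial.aeval_C,
          Polynomial.algebraMap_eq]
      · simp only [expCurve, derivative_one, rDerivVal, trace_eq_zero_of_isNilpotent' hA,
          neg_zero, map_zero, zero_mul]
    rw [map_mul, MvPolynomial.aeval_X, derivative_mul, hp, hc, Derivation.leibniz, smul_eq_mul,
      smul_eq_mul, map_add, map_mul, map_mul, MvPolynomial.aeval_X, rDeriv_X]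
    ring

end ExpCurve

/-! ### Chevalley: nilpotent elements of `Lie(G)` exponentiate into `G` -/

section Exp

open Polynomial

variable [CharZero k] {G : Subgroup (GL n k)}

/-- **Nilpotent elements of the Lie algebra exponentiate into the group (characteristic `0`).**
Let `G ≤ GL n k` be an algebraic subgroup over a field of characteristic `0` and `A ∈ Lie(G)` a
nilpotent matrix. Then `exp (x A) ∈ G` for every `x ∈ k`. Proof: for `p ∈ 𝓘(G)` put
`F_p(x) = p(exp (x A)) ∈ k[x]`; then `F_p(0) = p(1) = 0` and `F_p' = F_{D_A p}` (chain rule) with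
`D_A p ∈ 𝓘(G)` (`rDeriv_mem_idealGL`). If some `F_p ≠ 0`, one of least degree is
non-constant, so `F_p' = F_{D_A p} ≠ 0` has smaller degree — a contradiction. Hence every
`p ∈ 𝓘(G)` vanishes at `exp (x A)`, which therefore lies in the closed set `G = 𝓥(𝓘(G))`.
(Chevalley's correspondence between algebraic groups and their Lie algebras in characteristic
`0`: Borel, *Linear Algebraic Groups*, §7; Humphreys, *Linear Algebraic Groups*, §13, 15.)
[folklore] -/
theorem expHom_mem_of_mem_lieAlgebraGL (hG : IsAlgebraicSubgroup G) {A : Matrix n n k}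
    (hA : A ∈ lieAlgebraGL G) (hAn : IsNilpotent A) (x : Multiplicative k) :
    expHom A hAn x ∈ G := by
  classical
  obtain ⟨N, hN⟩ := id hAn
  set I := MvPolynomial.vanishingIdeal k (glCoordFun '' (G : Set (GL n k))) with hI
  suffices h : ∀ p ∈ I, MvPolynomial.aeval (expCurve A N) p = 0 by
    obtain ⟨S, hS⟩ := hG
    have hx : expHom A hAn x ∈ zeroLocusGL (I : Set (MvPolynomial (GLCoord n) k)) := by
      intro p hp
      have e := congrArg (Polynomial.eval (Multiplicative.toAdd x)) (h p hp)
      rwa [eval_aeval_expCurve hAn hN, Polynomial.eval_zero, ofAdd_toAdd] at e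
    rw [hI, zeroLocusGL_vanishingIdeal hS] at hx
    exact hx
  by_contra hcon
  push Not at hcon
  let P : ℕ → Prop := fun d => ∃ p ∈ I, MvPolynomial.aeval (expCurve A N) p ≠ 0 ∧
    (MvPolynomial.aeval (expCurve A N) p).natDegree = d
  have hP : ∃ d, P d := by
    obtain ⟨p, hp, hp0⟩ := hcon
    exact ⟨_, p, hp, hp0, rfl⟩
  obtain ⟨p, hpI, hp0, hpdeg⟩ := Nat.find_spec hP
  set F := MvPolynomial.aeval (expCurve A N) p with hF
  have hF0 : F.eval 0 = 0 := by
    rw [hF, eval_aeval_expCurve hAn hN, ofAdd_zero, map_one]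
    exact (mem_vanishingIdeal_glCoordFun_iff.1 hpI) 1 G.one_mem
  have hdeg : F.natDegree ≠ 0 := by
    intro h0
    apply hp0
    rw [Polynomial.eq_C_of_natDegree_eq_zero h0, Polynomial.coeff_zero_eq_eval_zero, hF0, map_zero]
  have hlt : (derivative F).natDegree < F.natDegree := natDegree_derivative_lt hdeg
  have hF' : derivative F ≠ 0 := fun h => hdeg (Polynomial.derivative_eq_zero.1 h)
  rw [hpdeg] at hlt
  refine Nat.find_min hP hlt ⟨rDeriv A p, rDeriv_mem_idealGL hA hpI, ?_, ?_⟩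
  · rwa [← derivative_aeval_expCurve hAn hN]
  · rw [← derivative_aeval_expCurve hAn hN]

end Exp

/-! ### Weight vectors of non-trivial weights are nilpotent -/

section NilpotentWeightVectors

open Polynomial

/-- The reversed characteristic polynomial of a scalar multiple: `det (1 - x c A) = det (1 - (c x) A)`,
i.e. `charpolyRev (c • A) = (charpolyRev A) ∘ (c x)`. [folklore] -/
lemma charpolyRev_smul (c : k) (A : Matrix n n k) :
    (c • A).charpolyRev = A.charpolyRev.comp (C c * X) := by
  rw [Matrix.charpolyRev, Matrix.charpolyRev, comp_eq_aeval, AlgHom.map_det, AlgHom.mapMatrix_apply]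
  congr 1
  refine Matrix.ext fun i j => ?_
  by_cases hij : i = j
  · simp only [Matrix.sub_apply, Matrix.smul_apply, Matrix.map_apply, Matrix.one_apply, smul_eq_mul,
      map_sub, map_mul, aeval_X, aeval_C, Polynomial.algebraMap_eq, hij, if_true, map_one]
    ring
  · simp only [Matrix.sub_apply, Matrix.smul_apply, Matrix.map_apply, Matrix.one_apply, smul_eq_mul,
      map_sub, map_mul, aeval_X, aeval_C, Polynomial.algebraMap_eq, hij, if_false, map_zero]
    ring

/-- A matrix whose reversed characteristic polynomial `det (1 - x A)` is `1` is nilpotent: its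
characteristic polynomial is then `x ^ n` (Mathlib `Matrix.reverse_charpoly`), and
Cayley–Hamilton applies. [folklore] -/
theorem isNilpotent_of_charpolyRev_eq_one {A : Matrix n n k} (h : A.charpolyRev = 1) :
    IsNilpotent A := by
  set N := Fintype.card n
  have hdeg : A.charpoly.natDegree = N := Matrix.charpoly_natDegree_eq_dim A
  have hrev : A.charpoly.reverse = 1 := by rw [Matrix.reverse_charpoly, h]
  have hcoeff : ∀ j < N, A.charpoly.coeff j = 0 := by
    intro j hj
    have hc := congrArg (fun q : k[X] => q.coeff (N - j)) hrev
    simp only [coeff_reverse, hdeg, revAt_le (Nat.sub_le N j), Nat.sub_sub_self hj.le,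
      coeff_one, Nat.sub_eq_zero_iff_le, not_le.2 hj, if_false] at hc
    exact hc
  have hp : A.charpoly = X ^ N := by
    refine Polynomial.ext fun j => ?_
    rw [coeff_X_pow]
    rcases lt_trichotomy j N with hj | rfl | hj
    · rw [hcoeff j hj, if_neg hj.ne]
    · rw [if_pos rfl, ← hdeg]
      exact (Matrix.charpoly_monic A).coeff_natDegree
    · rw [if_neg hj.ne', coeff_eq_zero_of_natDegree_lt (hdeg ▸ hj)]
  refine ⟨N, ?_⟩
  have hCH := Matrix.aeval_self_charpoly A
  rwa [hp, map_pow, aeval_X] at hCH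

variable {T : Subgroup (GL n k)}

/-- **Weight vectors of a non-trivial weight are nilpotent.** Let `T ≤ GL n k` be Zariski
connected, `α ≠ 1` an algebraic character of `T` and `A ∈ 𝔤𝔩ₙ` with `t A t⁻¹ = α(t) A` for all
`t ∈ T`. Then `A` is nilpotent: conjugation does not change `det (1 - x A)` while
`det (1 - x α(t) A) = det (1 - x A) ∘ (α(t) x)`, so the `i`-th coefficient `c_i` satisfies
`c_i α(t)ⁱ = c_i`; if `c_i ≠ 0` then `αⁱ = 1`, which forces `α = 1` because the character group of
a connected group is torsion-free (`eq_one_of_isZConnected_of_pow_eq_one`, Springer 3.2.7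
(iii)). Hence `det (1 - x A) = 1` and `A` is nilpotent. (Springer 7.3, proof of 7.3.1: the
weight vectors of `T` for non-zero weights act nilpotently.) [folklore] -/
theorem isNilpotent_of_mem_weightSpaceGL (hT : IsZConnected T) {α : ↥T →* kˣ}
    (hα : IsAlgebraicChar α) (hα1 : α ≠ 1) {A : Matrix n n k} (hA : A ∈ weightSpaceGL T α) :
    IsNilpotent A := by
  apply isNilpotent_of_charpolyRev_eq_one
  have hcoeff : ∀ i, i ≠ 0 → A.charpolyRev.coeff i = 0 := by
    intro i hi
    by_contra hne
    apply hα1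
    refine eq_one_of_isZConnected_of_pow_eq_one hT hα hi (MonoidHom.ext fun t => Units.ext ?_)
    have h1 : (((α t : kˣ) : k) • A).charpolyRev = A.charpolyRev := by
      rw [← mem_weightSpaceGL_iff.1 hA t, ← Matrix.reverse_charpoly, ← Matrix.reverse_charpoly,
        Matrix.charpoly_units_conj]
    have h2 := congrArg (fun q : k[X] => q.coeff i) h1
    simp only [charpolyRev_smul, comp_C_mul_X_coeff] at h2
    have h3 : ((α t : kˣ) : k) ^ i = 1 := by
      have h4 : A.charpolyRev.coeff i * ((α t : kˣ) : k) ^ i = A.charpolyRev.coeff i * 1 := by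
        rw [h2, mul_one]
      exact mul_left_cancel₀ hne h4
    simpa using h3
  refine Polynomial.ext fun i => ?_
  rcases Nat.eq_zero_or_pos i with rfl | hi
  · rw [coeff_zero_eq_eval_zero, Matrix.eval_charpolyRev, coeff_one, if_pos rfl]
  · rw [hcoeff i hi.ne', coeff_one, if_neg hi.ne']

end NilpotentWeightVectors

/-! ### The non-zero weights of `T` on `Lie(G)` are roots (`P ⊆ R`, characteristic `0`) -/

section WeightsAreRoots

variable [CharZero k] {G T : Subgroup (GL n k)}

/-- **Every non-zero weight of `T` in `Lie(G)` is a root, in characteristic `0`** (the inclusion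
`P ⊆ R` of Springer 8.1.2, *"The roots of `R` are the non-zero weights of `T` in `𝔤`"*, for
the roots `roots G T` defined through root homomorphisms, 8.1.1 (i)). Let `G ≤ GL n k` be
algebraic over a field of characteristic `0` and `T ≤ G` Zariski connected (e.g. a torus). If
`α ≠ 1` has a non-zero weight vector `A ∈ 𝔤_α ⊆ Lie(G)`, then `A` is nilpotent
(`isNilpotent_of_mem_weightSpaceGL`), `x ↦ exp (x A)` takes values in `G`
(`expHom_mem_of_mem_lieAlgebraGL`) and is a root homomorphism for `α`
(`isRootHom_codRestrict_expHom`), so `α ∈ roots G T`. Springer proves `P = R` for `G` connected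
reductive and `T` a maximal torus in every characteristic through the groups `G_α` of
semisimple rank one (7.1, 7.3, 7.6.4 (i)); in characteristic `0` this half needs neither
hypothesis. The reverse inclusion `R ⊆ P` is `roots_subset_lieWeights` (`LieAlgebraGL.lean`).
[cite: SpringerLAG1998, Cor. 8.1.2] -/
theorem lieWeights_subset_roots (hG : IsAlgebraicSubgroup G) (hT : IsZConnected T)
    (hTG : T ≤ G) : lieWeights G T ⊆ roots G T := by
  intro α hα
  obtain ⟨hα1, A, hAG, hA0, hAw⟩ := mem_lieWeights_iff.1 hα
  have hAn : IsNilpotent A := isNilpotent_of_mem_weightSpaceGL hT α.2 hα1 hAw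
  refine mem_roots_of_expHom hTG hAn hA0 (fun x => expHom_mem_of_mem_lieAlgebraGL hG hAG hAn x)
    hα1 fun t => ?_
  rw [Matrix.coe_units_inv]
  exact hAw t

/-- Hence, in characteristic `0`, **the non-zero weights of `T` in `Lie(G)` are exactly the roots**
(`P = R`, first clause of Springer 8.1.2) for any algebraic `G ≤ GL n k` and Zariski-connected
`T ≤ G` (with `roots_subset_lieWeights` for `R ⊆ P`). [cite: SpringerLAG1998, Cor. 8.1.2] -/
theorem lieWeights_eq_roots_of_charZero (hG : IsAlgebraicSubgroup G) (hT : IsZConnected T)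
    (hTG : T ≤ G) : lieWeights G T = roots G T :=
  Set.Subset.antisymm (lieWeights_subset_roots hG hT hTG) roots_subset_lieWeights

/-- In characteristic `0` every weight space `𝔤_α` of a root `α` is spanned by velocities of root
homomorphisms: each non-zero `A ∈ 𝔤_α` is nilpotent and `x ↦ exp (x A)` is a root homomorphism of
`(G, T)` for `α` with values in `G`. Recorded as: the exponential of every non-zero
`A ∈ 𝔤_α` lies in the root subgroup `U_α = rootSubgroup G T α`. [cite: SpringerLAG1998, 8.1.1 (i)] -/
theorem expHom_mem_rootSubgroup_of_mem_lieWeightSpace (hG : IsAlgebraicSubgroup G)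
    (hT : IsZConnected T) (hTG : T ≤ G) {α : ↥T →* kˣ} (hα : IsAlgebraicChar α) (hα1 : α ≠ 1)
    {A : Matrix n n k} (hA : A ∈ lieWeightSpace G T α) (hA0 : A ≠ 0) (x : Multiplicative k) :
    ∃ hAn : IsNilpotent A, expHom A hAn x ∈ rootSubgroup G T α := by
  have hAn : IsNilpotent A := isNilpotent_of_mem_weightSpaceGL hT hα hα1 hA.2
  refine ⟨hAn, expHom_mem_rootSubgroup hTG hAn hA0
    (fun y => expHom_mem_of_mem_lieAlgebraGL hG hA.1 hAn y) (fun t => ?_) x⟩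
  rw [Matrix.coe_units_inv]
  exact hA.2 t

end WeightsAreRoots

end Literature.NumberTheory.Automorphic
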